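import Summits.ResolutionOfSingularities.ResolutionOfSingularities.Theorems.SharpStrataSepExcModelsRatAbhyankarModel
import Summits.ResolutionOfSingularities.ResolutionOfSingularities.Theorems.SharpStrataSepExcModelsModelDescends
import Literature.FieldTheory.Separability.FormallySmoothSeparablyGenerated
import HarnessLib

/-!
# A residually separable Abhyankar place dominating `A_P` yields a separable regular local model

Line `birth` of crux `SharpStrata.SepExcModels` (stmt-ResolutionOfSingularities-16828,
`Cruxes/SepExcModels/Lines/birth.lean`), lead c1, tool stub (T2sep, ring form)
`stub_model_of_sepAbhyankarPlace`, PROVED.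

Setting: `k` perfect, `A` a finitely generated `k`-algebra with fraction field `K`, `R = A_P` realised
inside `K`, and `O` a valuation ring of `K` receiving `R` by `φ : R → O` (compatible with `R → K`),
dominating it (`𝔪_R ⊆ φ⁻¹ 𝔪_O`), an ABHYANKAR place of `K | k` (`IsAbhyankarPlace`,
`Literature/…/ValuedFunctionFields.lean`), whose residue field extension `κ(O) / κ(R)` is formally
smooth (= separable; it is finitely generated). Conclusion (the third disjunct of `SepExcAt` in ring
form): some `B = R[s] ⊆ K` (`s` finite) carries a prime `𝔮` over `𝔪_R` with `B_𝔮` regular and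
`(B/𝔮)[1/g]` smooth over `κ(R) = R/𝔪_R` for some `g ∉ 𝔮`. This weakens the residual RATIONALITY of
the sibling `stub_model_of_ratAbhyankarPlace` (`…RatAbhyankarModel.lean`) to residual SEPARABILITY.

## Proof

* Steps (1)–(6) are those of the rational sibling: Knaf–Kuhlmann 2005, Thm. 1.1
  (`relLU_at_abhyankarPlace_of_perfectField`) applied to the image of `A` in `K` gives a finitely
  generated `N = k[t] ⊇ A` inside `O`, birational and regular at the centre; `B := R[t]`,
  `𝔮 := 𝔪_O ∩ B` (a prime over `𝔪_R` by domination); `B_𝔮 = N_{centre}` is regular by the sandwich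
  `N ⊆ B ⊆ O` (`isRegularLocalRing_localization_of_sandwich`).
* Step (7), smoothness: `D := B/𝔮` is a finitely generated `κ(R)`-domain which EMBEDS into
  `E := κ(O)` over `κ(R)` (the kernel of `B → O → κ(O)` is exactly `𝔮`), hence so does its fraction
  field `F`. MacLane's condition passes from `E` (where it holds by formal smoothness,
  `linearIndepOn_pow_of_formallySmooth`, Matsumura 26.9) to the subextension `F` (linear
  independence is tested inside `E`), so `F / κ(R)` is separably generated (Mathlib, Stacks 030W)
  hence formally smooth (`Algebra.FormallySmooth.of_algebraicIndependent_of_isSeparable`); thus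
  `D` is smooth over `κ(R)` at its generic point and, being of finite type over a field, on a
  non-empty basic open `D(g)` (`exists_smooth_away_of_isSmoothAt_bot`, openness of the smooth
  locus).

## Sources

* H. Knaf, F.-V. Kuhlmann, *Abhyankar places admit local uniformization in any characteristic*,
  Ann. Sci. ÉNS 38 (2005) 833–846, Thm. 1.1. [KnafKuhlmann2005]
* A. Benito, O. Piltant, A. J. Reguera, *Small irreducible components of arc spaces in positive
  characteristic*, J. Pure Appl. Algebra 226 (2022) 107113, Question 6.6. [BenitoPiltantReguera2022]
* H. Matsumura, *Commutative Ring Theory*, Thm. 26.9; The Stacks Project, Tag 030W. [Matsumura1987]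
-/

noncomputable section

-- single-problem summit: the doubled namespace component `ResolutionOfSingularities` is forced
set_option linter.dupNamespace false

open Literature.AlgebraicGeometry.Resolution IsLocalRing
open Literature.FieldTheory.Separability
open Summit.ResolutionOfSingularities.ResolutionOfSingularities.Theorems.SepExcModels.ModelSpreads
open Summit.ResolutionOfSingularities.ResolutionOfSingularities.Theorems.SepExcModels.ModelDescends

namespace Summit.ResolutionOfSingularities.ResolutionOfSingularities.Theorems.SepExcModels.SepAbhyankarModel

/-! ## Formal smoothness passes to essentially finitely generated subextensions -/

/-- **A finitely generated subextension of a formally smooth field extension is formally smooth.**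
If `F → E` is a homomorphism of field extensions of `κ`, `E / κ` is formally smooth and `F / κ` is
essentially of finite type, then `F / κ` is formally smooth: in characteristic `p`, MacLane's
condition (`p`-th powers of `κ`-linearly independent elements stay independent) holds in `E`
(Matsumura 26.9, `linearIndepOn_pow_of_formallySmooth`) hence in `F` (test inside `E`), so `F` is
separably generated (Stacks 030W) and formally smooth; in characteristic `0`, `κ` is perfect.
[cite: Matsumura1987, Thm. 26.9] -/
theorem formallySmooth_of_algHom_of_essFiniteType {κ F E : Type*} [Field κ] [Field F] [Field E]
    [Algebra κ F] [Algebra κ E] [Algebra.EssFiniteType κ F] [Algebra.FormallySmooth κ E]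
    (f : F →ₐ[κ] E) : Algebra.FormallySmooth κ F := by
  classical
  obtain _ | ⟨p, hp, _⟩ := CharP.exists' κ
  · haveI : PerfectField κ := PerfectField.ofCharZero
    exact Algebra.FormallySmooth.of_perfectField
  haveI : Fact p.Prime := hp
  haveI : ExpChar κ p := ExpChar.prime hp.out
  have hf : Function.Injective f := f.toRingHom.injective
  obtain ⟨t, ht, H⟩ :=
    exists_isTranscendenceBasis_and_isSeparable_of_linearIndepOn_pow_of_essFiniteType (K := F) p
      hp.out fun s hs => by
        -- MacLane's condition in `E`, pulled back along the injective `κ`-linear map `f`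
        have h1 : LinearIndepOn κ _root_.id ((s.image f : Finset E) : Set E) := by
          rw [Finset.coe_image]
          exact (hs.map_injOn f.toLinearMap (hf.injOn)).id_image
        have h2 := linearIndepOn_pow_of_formallySmooth p (s.image f) h1
        rw [Finset.coe_image] at h2
        refine LinearIndepOn.of_comp f.toLinearMap ?_
        have h4 : (⇑f.toLinearMap ∘ fun x : F => x ^ p) = ((fun y : E => y ^ p) ∘ f) := by
          ext x
          simp [map_pow]
        rw [h4]
        exact h2.comp_of_image hf.injOn
  have : Algebra.IsSeparable (IntermediateField.adjoin κ (Set.range ((↑) : t → F))) F := by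
    convert! H <;> simp
  exact .of_algebraicIndependent_of_isSeparable ht.1

/-- **The fraction field of a finitely generated domain embedding into a formally smooth field
extension is formally smooth.** If `D` is a domain of finite type over a field `κ` with an
injective `κ`-algebra map into a field `E` formally smooth over `κ`, then `Frac D` is formally
smooth over `κ` (it embeds into `E`; `formallySmooth_of_algHom_of_essFiniteType`). [folklore] -/
theorem formallySmooth_fractionRing_of_injective {κ D E : Type*} [Field κ] [CommRing D]
    [IsDomain D] [Field E] [Algebra κ D] [Algebra κ E] [Algebra.FiniteType κ D]
    [Algebra.FormallySmooth κ E] (g : D →ₐ[κ] E) (hg : Function.Injective g) :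
    Algebra.FormallySmooth κ (FractionRing D) := by
  haveI : Algebra.EssFiniteType D (FractionRing D) :=
    Algebra.EssFiniteType.of_isLocalization (FractionRing D) (nonZeroDivisors D)
  haveI : Algebra.EssFiniteType κ (FractionRing D) :=
    Algebra.EssFiniteType.comp κ D (FractionRing D)
  exact formallySmooth_of_algHom_of_essFiniteType
    (IsFractionRing.liftAlgHom (K := FractionRing D) hg)

/-- **Generic smoothness of the centre of a dominated local ring with separable residue field
extension.** Let `R → S` be of finite type, `R` and `O` local, `ι : S → O` and `φ : R → O`
compatible, `φ` dominating (`𝔪_R ⊆ φ⁻¹ 𝔪_O`) with `κ(O) / κ(R)` formally smooth, and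
`𝔮 = ι⁻¹ 𝔪_O`. Then `D = S/𝔮`, a finitely generated `κ(R)`-domain embedding into `κ(O)`, has
formally smooth fraction field (`formallySmooth_fractionRing_of_injective`), so `D[1/g]` is
smooth over `κ(R)` for some `g ∉ 𝔮` (openness of the smooth locus,
`exists_smooth_away_of_isSmoothAt_bot`). [folklore] -/
theorem exists_smooth_away_of_formallySmooth_residue {R S O : Type*} [CommRing R]
    [IsLocalRing R] [CommRing S] [Algebra R S] [Algebra.FiniteType R S] [CommRing O]
    [IsLocalRing O] (ι : S →+* O) (φ : R →+* O) (hιφ : ∀ r : R, ι (algebraMap R S r) = φ r)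
    (hdom : maximalIdeal R ≤ (maximalIdeal O).comap φ)
    (hsep : @Algebra.FormallySmooth (R ⧸ maximalIdeal R) (O ⧸ maximalIdeal O) _ _
      (Ideal.quotientMap (maximalIdeal O) φ hdom).toAlgebra)
    (𝔮 : Ideal S) [𝔮.IsPrime] (h𝔮 : 𝔮 = (maximalIdeal O).comap ι)
    (hle : maximalIdeal R ≤ 𝔮.comap (algebraMap R S)) :
    ∃ g : S, g ∉ 𝔮 ∧ @Algebra.Smooth (R ⧸ maximalIdeal R) _
      (Localization.Away (Ideal.Quotient.mk 𝔮 g)) _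
      ((algebraMap _ (Localization.Away (Ideal.Quotient.mk 𝔮 g))).comp
        (Ideal.quotientMap 𝔮 (algebraMap R S) hle)).toAlgebra := by
  -- the residue field extension `κ(R) → κ(O)`
  letI algκE : Algebra (R ⧸ maximalIdeal R) (O ⧸ maximalIdeal O) :=
    (Ideal.quotientMap (maximalIdeal O) φ hdom).toAlgebra
  have hκE : ∀ r : R, algebraMap (R ⧸ maximalIdeal R) (O ⧸ maximalIdeal O)
      (Ideal.Quotient.mk _ r) = Ideal.Quotient.mk _ (φ r) := fun r => rfl
  -- `D = S/𝔮` over `κ(R)`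
  letI algκD : Algebra (R ⧸ maximalIdeal R) (S ⧸ 𝔮) := Ideal.Quotient.algebraQuotientOfLEComap hle
  have hκD : ∀ r : R, algebraMap (R ⧸ maximalIdeal R) (S ⧸ 𝔮) (Ideal.Quotient.mk _ r) =
      Ideal.Quotient.mk 𝔮 (algebraMap R S r) := fun r => rfl
  haveI : IsScalarTower R (R ⧸ maximalIdeal R) (S ⧸ 𝔮) :=
    IsScalarTower.of_algebraMap_eq fun r => (hκD r).symm
  haveI : Algebra.FiniteType (R ⧸ maximalIdeal R) (S ⧸ 𝔮) :=
    Algebra.FiniteType.of_restrictScalars_finiteType R _ _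
  -- the embedding `D → κ(O)` over `κ(R)`
  let g₀ : S ⧸ 𝔮 →+* O ⧸ maximalIdeal O := Ideal.quotientMap (maximalIdeal O) ι h𝔮.le
  have hg₀ : ∀ s : S, g₀ (Ideal.Quotient.mk 𝔮 s) = Ideal.Quotient.mk _ (ι s) := fun s => rfl
  have hg₀inj : Function.Injective g₀ := Ideal.quotientMap_injective' h𝔮.ge
  let g : (S ⧸ 𝔮) →ₐ[R ⧸ maximalIdeal R] (O ⧸ maximalIdeal O) :=
    { g₀ with
      commutes' := fun c => by
        obtain ⟨r, rfl⟩ := Ideal.Quotient.mk_surjective c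
        change g₀ (algebraMap _ _ (Ideal.Quotient.mk _ r)) = algebraMap _ _ (Ideal.Quotient.mk _ r)
        rw [hκD, hκE, hg₀, hιφ] }
  have hg : Function.Injective g := fun x y h => hg₀inj h
  -- `Frac D` is formally smooth over `κ(R)`, i.e. `D` is smooth at its generic point
  have hsmF : Algebra.FormallySmooth (R ⧸ maximalIdeal R) (FractionRing (S ⧸ 𝔮)) := by
    letI := Ideal.Quotient.field (maximalIdeal R)
    letI := Ideal.Quotient.field (maximalIdeal O)
    haveI : Algebra.FormallySmooth (R ⧸ maximalIdeal R) (O ⧸ maximalIdeal O) := hsep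
    exact formallySmooth_fractionRing_of_injective g hg
  have hsmAt : Algebra.IsSmoothAt (R ⧸ maximalIdeal R) (⊥ : Ideal (S ⧸ 𝔮)) :=
    isSmoothAt_bot_of_formallySmooth_fractionRing
  haveI : IsNoetherianRing (R ⧸ maximalIdeal R) := by
    letI := Ideal.Quotient.field (maximalIdeal R)
    infer_instance
  have hfp : Algebra.FinitePresentation (R ⧸ maximalIdeal R) (S ⧸ 𝔮) :=
    (Algebra.FinitePresentation.of_finiteType).mp ‹_›
  exact exists_smooth_away_of_isSmoothAt_bot (maximalIdeal R) 𝔮 hle hfp hsmAt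

/-! ## The stub -/

/-- **A residually separable Abhyankar place dominating `R = A_P` yields a separable regular
birational local model** (registered tool stub T2sep, ring form, of line `birth` of crux
`SepExcModels`). Let `k` be perfect, `A` a finitely generated `k`-algebra with fraction field `K`,
`R = A_P` (inside `K`), and `O` a valuation ring of `K` receiving `R` by `φ` (compatibly with
`R → K`), dominating it (`𝔪_R ⊆ φ⁻¹ 𝔪_O`), Abhyankar over (the image of) `k`, with `κ(O) / κ(R)`
formally smooth. Then some `B = R[s] ⊆ K` (`s` finite) has a prime `𝔮` over `𝔪_R` with `B_𝔮`
regular and `(B/𝔮)[1/g]` smooth over `κ(R)` for some `g ∉ 𝔮`. Proof: Knaf–Kuhlmann 2005 Thm. 1.1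
(`relLU_at_abhyankarPlace_of_perfectField`, applied to the image of `A`) gives a finitely
generated `N = k[t] ⊇ A` inside `O`, birational and regular at the centre; `B := R[t]`,
`𝔮 := 𝔪_O ∩ B`; `B_𝔮 = N_{centre}` by the sandwich (`isRegularLocalRing_localization_of_sandwich`);
and `Frac(B/𝔮) ⊆ κ(O)` is formally smooth over `κ(R)` (MacLane's condition descends to finitely
generated subextensions), whence a smooth basic open of `Spec B/𝔮`
(`exists_smooth_away_of_formallySmooth_residue`). [cite: KnafKuhlmann2005, Thm. 1.1] -/
theorem stub_model_of_sepAbhyankarPlace {k A K R : Type} [Field k] [PerfectField k]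
    [CommRing A] [Algebra k A] [Algebra.FiniteType k A] [Field K] [Algebra k K] [Algebra A K]
    [IsScalarTower k A K] [IsFractionRing A K] [CommRing R] [IsLocalRing R] [Algebra A R]
    [Algebra R K] [IsScalarTower A R K] (P : Ideal A) [P.IsPrime] [IsLocalization.AtPrime R P]
    (hfg : (⊤ : IntermediateField k K).FG)
    (O : ValuationSubring K) (φ : R →+* O) (hφ : ∀ r : R, (φ r : K) = algebraMap R K r)
    (hdom : IsLocalRing.maximalIdeal R ≤ (IsLocalRing.maximalIdeal O).comap φ)
    (hAbh : IsAbhyankarPlace O (algebraMap k K).fieldRange ⊤)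
    (hsep : @Algebra.FormallySmooth (R ⧸ IsLocalRing.maximalIdeal R)
      (O ⧸ IsLocalRing.maximalIdeal O) _ _
      (Ideal.quotientMap (IsLocalRing.maximalIdeal O) φ hdom).toAlgebra) :
    ∃ (s : Finset K) (𝔮 : Ideal (Algebra.adjoin R (s : Set K))) (_ : 𝔮.IsPrime)
      (hle : IsLocalRing.maximalIdeal R ≤
        𝔮.comap (algebraMap R (Algebra.adjoin R (s : Set K)))),
      IsRegularLocalRing (Localization.AtPrime 𝔮) ∧
        ∃ g : Algebra.adjoin R (s : Set K), g ∉ 𝔮 ∧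
          @Algebra.Smooth (R ⧸ IsLocalRing.maximalIdeal R) _
            (Localization.Away (Ideal.Quotient.mk 𝔮 g)) _
            ((algebraMap _ (Localization.Away (Ideal.Quotient.mk 𝔮 g))).comp
              (Ideal.quotientMap 𝔮 (algebraMap R (Algebra.adjoin R (s : Set K))) hle)).toAlgebra := by
  classical
  -- (1) `A ⊆ R ⊆ O` and `k ⊆ O` inside `K`
  have hRO : ∀ r : R, algebraMap R K r ∈ O := fun r => by
    rw [← hφ]
    exact (φ r).2
  have hAK : ∀ a : A, algebraMap A K a = algebraMap R K (algebraMap A R a) :=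
    fun a => IsScalarTower.algebraMap_apply A R K a
  have hAO : ∀ a : A, algebraMap A K a ∈ O := fun a => by
    rw [hAK]
    exact hRO _
  have hk : ∀ c : k, algebraMap k K c ∈ O := fun c => by
    rw [IsScalarTower.algebraMap_apply k A K]
    exact hAO _
  -- (2) the image `A'` of `A` in `K`: finitely generated, inside `O`, with fraction field `K`
  set A' : Subalgebra k K := (IsScalarTower.toAlgHom k A K).range with hA'def
  have hmemA' : ∀ a : A, algebraMap A K a ∈ A' := fun a => (AlgHom.mem_range _).mpr ⟨a, rfl⟩
  have hA'fg : A'.FG := by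
    rw [hA'def, ← Algebra.map_top]
    exact Subalgebra.FG.map _ Algebra.FiniteType.out
  have hA'O : A'.toSubring ≤ O.toSubring := by
    intro x hx
    obtain ⟨a, rfl⟩ := (AlgHom.mem_range _).mp (Subalgebra.mem_toSubring.mp hx)
    exact hAO a
  -- (3) Knaf–Kuhlmann 2005, Thm. 1.1 (relative affine form over the perfect field `k`)
  obtain ⟨N, hNO, hA'N, ⟨t, ht⟩, hNfr, hNreg⟩ :=
    relLU_at_abhyankarPlace_of_perfectField hfg O hk hAbh A' hA'fg hA'O
  have htN : (t : Set K) ⊆ N := ht ▸ Algebra.subset_adjoin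
  have hAN : ∀ a : A, algebraMap A K a ∈ N := fun a => hA'N (hmemA' a)
  -- (4) `B := R[t]`, sandwiched `N ⊆ B ⊆ O`
  set B : Subalgebra R K := Algebra.adjoin R (t : Set K) with hBdef
  have hBO : B.toSubring ≤ O.toSubring := by
    intro x hx
    refine Algebra.adjoin_induction (p := fun x _ => x ∈ O) ?_ ?_ ?_ ?_ (show x ∈ B from hx)
    · exact fun x hx => hNO (htN hx)
    · exact fun r => hRO r
    · exact fun _ _ _ _ hx hy => add_mem hx hy
    · exact fun _ _ _ _ hx hy => mul_mem hx hy
  have hNB : N.toSubring ≤ B.toSubring := by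
    intro x hx
    have hx' : x ∈ Algebra.adjoin k (t : Set K) := ht ▸ (show x ∈ N from hx)
    refine Algebra.adjoin_induction (p := fun x _ => x ∈ B) ?_ ?_ ?_ ?_ hx'
    · exact fun x hx => Algebra.subset_adjoin hx
    · intro c
      rw [IsScalarTower.algebraMap_apply k A K, hAK]
      exact B.algebraMap_mem _
    · exact fun _ _ _ _ hx hy => add_mem hx hy
    · exact fun _ _ _ _ hx hy => mul_mem hx hy
  -- (5) the centre `𝔮 := 𝔪_O ∩ B`, a prime over `𝔪_R` (`B → O` restricts `φ` along `R → B`)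
  set 𝔮 : Ideal B := Ideal.comap (Subring.inclusion hBO : B →+* O) (maximalIdeal O) with h𝔮def
  haveI h𝔮 : 𝔮.IsPrime := Ideal.comap_isPrime _ _
  have hmem𝔮 : ∀ b : B, b ∈ 𝔮 ↔ O.valuation (b : K) < 1 := fun b =>
    Ideal.mem_comap.trans (ValuationSubring.valuation_lt_one_iff O _)
  have hιφ : ∀ r : R, (Subring.inclusion hBO : B →+* O) (algebraMap R B r) = φ r := fun r =>
    Subtype.ext (by rw [Subring.coe_inclusion, hφ]; rfl)
  have hle : maximalIdeal R ≤ 𝔮.comap (algebraMap R B) := fun r hr => by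
    rw [Ideal.mem_comap, h𝔮def, Ideal.mem_comap, hιφ]
    exact hdom hr
  -- (6) regularity of `B_𝔮 = N_𝔫` by the sandwich
  have hunitv : ∀ u : P.primeCompl, O.valuation (algebraMap A K (u : A)) = 1 := fun u => by
    obtain ⟨v, hv⟩ := IsLocalization.map_units R u
    refine valuation_eq_one_of_mul_eq_one O (y := algebraMap R K (↑v⁻¹ : R)) (hAO u) (hRO _) ?_
    rw [hAK, ← hv, ← map_mul, Units.mul_inv, map_one]
  have hQ : ∀ x ∈ B, ∃ a u : K, a ∈ N ∧ u ∈ N ∧ O.valuation u = 1 ∧ x * u = a := by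
    intro x hx
    refine Algebra.adjoin_induction (p := fun x _ => ∃ a u : K, a ∈ N ∧ u ∈ N ∧
      O.valuation u = 1 ∧ x * u = a) ?_ ?_ ?_ ?_ hx
    · intro x hx
      exact ⟨x, 1, htN hx, one_mem _, map_one _, mul_one _⟩
    · intro r
      obtain ⟨a, u, rfl⟩ := IsLocalization.exists_mk'_eq P.primeCompl r
      refine ⟨algebraMap A K a, algebraMap A K (u : A), hAN a, hAN u, hunitv u, ?_⟩
      rw [hAK, hAK, ← map_mul, IsLocalization.mk'_spec]
    · rintro x y - - ⟨a₁, s₁, ha₁, hs₁, hv₁, h₁⟩ ⟨a₂, s₂, ha₂, hs₂, hv₂, h₂⟩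
      refine ⟨a₁ * s₂ + a₂ * s₁, s₁ * s₂, add_mem (mul_mem ha₁ hs₂) (mul_mem ha₂ hs₁),
        mul_mem hs₁ hs₂, by rw [map_mul, hv₁, hv₂, mul_one], ?_⟩
      rw [← h₁, ← h₂]; ring
    · rintro x y - - ⟨a₁, s₁, ha₁, hs₁, hv₁, h₁⟩ ⟨a₂, s₂, ha₂, hs₂, hv₂, h₂⟩
      refine ⟨a₁ * a₂, s₁ * s₂, mul_mem ha₁ ha₂, mul_mem hs₁ hs₂,
        by rw [map_mul, hv₁, hv₂, mul_one], ?_⟩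
      rw [← h₁, ← h₂]; ring
  haveI : IsFractionRing N.toSubring K := hNfr
  have hreg : IsRegularLocalRing (Localization.AtPrime 𝔮) := by
    refine isRegularLocalRing_localization_of_sandwich hNB 𝔮
      (Ideal.comap (Subring.inclusion hNO) (maximalIdeal O)) ?_ ?_ hNreg
    · rw [h𝔮def, Ideal.comap_comap]
      rfl
    · intro x
      obtain ⟨a, u, ha, hu, hv, hxu⟩ := hQ x x.2
      refine ⟨⟨a, ha⟩, ⟨u, hu⟩, ?_, hxu⟩
      rw [hmem𝔮]
      change ¬ O.valuation u < 1
      rw [hv]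
      exact lt_irrefl 1
  -- (7) `Frac(B/𝔮) ⊆ κ(O)` is formally smooth over `κ(R)`: a smooth basic open of `Spec B/𝔮`
  haveI : Algebra.FiniteType R B := Algebra.FiniteType.adjoin_of_finite (Finset.finite_toSet _)
  obtain ⟨g, hg, hsm⟩ := exists_smooth_away_of_formallySmooth_residue (S := B) (O := O)
    (Subring.inclusion hBO) φ hιφ hdom hsep 𝔮 h𝔮def hle
  exact ⟨t, 𝔮, h𝔮, hle, hreg, g, hg, hsm⟩

end Summit.ResolutionOfSingularities.ResolutionOfSingularities.Theorems.SepExcModels.SepAbhyankarModel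

end
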